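import Literature.AlgebraicGeometry.AbelianSchemes.HeckeQuotientTripleHasType
import Literature.AlgebraicGeometry.AbelianSchemes.AbelianSchemeConstSubgroupQuotientKernelCard
import Literature.AlgebraicGeometry.AbelianSchemes.AbelianSchemeOverFibreDim
import Literature.AlgebraicGeometry.AbelianSchemes.FibreHomRetractionKernelCount
import HarnessLib

/-!
# The `hasType` field of the Hecke quotient triple from the CARDINALITIES `|K| = n^g`, `|K|·|K′| = n^{2g}`

Topic `AlgebraicGeometry/AbelianSchemes`; namespace `Literature.AlgebraicGeometry.AbelianSchemes.AbelianSchemeOver`.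
THEOREMS ONLY (no definition, no named fact, no instance, no notation, no `sorry`; net Literature debt 0).  Cell
hodgecm-mathlib (D-0151), HECKE-LINK line, socket (B), `hExt.htype` (B-plan1 (g15) 00:34:18Z (2): «(DET) → `hKr` → B-p03
`hcount`»).  ★ `Polarization.hasType_polarizationDesc_of_count` (`HeckeQuotientTripleHasType`) with its per-point KERNEL COUNT
`|ker ψ_s| · |ker ψ^∨_s| = |A_s[n]|` DISCHARGED from the package's integer bookkeeping:
* `|ker ψ_s| = |K|` (★ `natCard_ker_fibreHom_quotientMk`, freeness);
* `|ker ψ^∨_s| · |K′| = |Â_s[n]|` — from the dual-side identity **`ψ̂ ≫ ψ^∨ = [n]_Â`** (hypothesis `hψhat`; B-p05 (g16)'s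
  lemma over ★ `quotientMk_eq_dualIsogenyOver_mulNDesc` «`ψ̂ = π^∨`», ★ `dualIsogenyOver_comp`, ★ `dualIsogenyOver_mulN`) read on
  `Ω`-points (★ `algPointsMap_algPointsMap_eq_pow_of_comp_eq_mulN`, `FibreHomRetractionKernelCount`), `ψ̂_s` onto with `|ker ψ̂_s| = |K′|`, and ★
  `IsogenyDegree.natCard_ker_comp_of_surjective`;
* `|A_s[n]| = |Â_s[n]| = n^{2g}` (★ `natCard_ker_powMonoidHom_eq`, ★ `dim_fibre_of_isOfRelDim` for `A`, the pointwise binder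
  `hdim'` for `Â` — B-p14 (g15) 01:28:26Z junction: at the piece only ★ `dim_hat_fibre_eq_of_classify` is available);
so that `hcount ⟸ |K| = n^g ∧ |K|·|K′| = n^{2g}` — exactly (DET) ★ `LevelStructure.natCard_eq_pow_of_mem_iff_heckeKernel`
(B-p15 (g10)) and B-p08 (g10)'s `hcard`.  Heads: **`Polarization.hasType_polarizationDesc_of_cards`** and its (DET)-free twin
**`Polarization.hasType_polarizationDesc_of_card_eq`** (binder `|K′| = |K|` — ★ `natCard_map_lam_eq_of_mem_iff` at the Hecke instance —
plus the relative dimensions; the composer's preferred socket, B-p04 (g18) 01:22:44Z).  HC_CM is proved only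
modulo the 7 printed citations until rung 0 closes; this file discharges none of them.

## References
* [MumfordAV1970] D. Mumford, *Abelian Varieties* (1970), §7 Thm. 4 (p. 72), §15 Thm. 1 (p. 143), §23 Thm. 2 (p. 231).
* [MumfordFogartyKirwan1994] D. Mumford, J. Fogarty, F. Kirwan, *Geometric Invariant Theory*, 3rd ed. (1994), App. 7A
  (pp. 234–235).
-/

set_option autoImplicit false

noncomputable section

universe u

open CategoryTheory CategoryTheory.Limits AlgebraicGeometry

open scoped MonObj

namespace Literature.AlgebraicGeometry.AbelianSchemes

namespace AbelianSchemeOver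

open Literature.AlgebraicGeometry.RelativeSpec Literature.AlgebraicGeometry.AbelianVarieties
  Literature.AlgebraicGeometry.Motives Literature.AlgebraicGeometry.Modules

variable {S : Scheme.{u}} [IsReduced S] [IsLocallyNoetherian S] (A : AbelianSchemeOver S)
  {Y : Scheme.{u}} (u : S ⟶ Y) (K : Subgroup A.Sections) [IsCommMonObj A.X] {n : ℕ}
  (hK : ∀ σ : K, (σ : A.Sections) ^ n = 1)
  [Finite K] [Y.IsSeparated] [IsSeparated (A.X.hom ≫ u)] [S.IsSeparated]
  (hcov : ∀ x : A.left, ∃ O : (A.translationActionOver u K).StableAffineOpens, x ∈ O.1)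
  [LocallyOfFiniteType (A.X.hom ≫ u)] [IsLocallyNoetherian Y]
  (hG : ∃ _ : GrpObj (A.quotientOver u K), IsMonHom (A.quotientMk u K hcov))
  (hsm : Smooth (A.quotientOver u K).hom) (hgc : GeometricallyConnected (A.quotientOver u K).hom)
  (D : A.DualPair) [IsAffine Y]
  (hfree : ∀ (Ω : Type u) [Field Ω] [IsAlgClosed Ω] (x : Spec (.of Ω) ⟶ A.left) (σ : K), σ ≠ 1 →
    x ≫ (A.translation (σ : A.Sections)).left ≠ x)
  (K' : Subgroup D.hat.Sections) [Finite K'] [IsSeparated (D.hat.X.hom ≫ u)]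
  (hcov' : ∀ x : D.hat.left, ∃ O : (D.hat.translationActionOver u K').StableAffineOpens, x ∈ O.1)
  [LocallyOfFiniteType (D.hat.X.hom ≫ u)]
  (hG' : ∃ _ : GrpObj (D.hat.quotientOver u K'), IsMonHom (D.hat.quotientMk u K' hcov'))
  (hsm' : Smooth (D.hat.quotientOver u K').hom) (hgc' : GeometricallyConnected (D.hat.quotientOver u K').hom)
  (hfree' : ∀ (Ω : Type u) [Field Ω] [IsAlgClosed Ω] (x : Spec (.of Ω) ⟶ D.hat.left) (σ : K'), σ ≠ 1 →
    x ≫ (D.hat.translation (σ : D.hat.Sections)).left ≠ x)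
  (Φ : (prodTranslationActionOver (A.quotientBy u K hcov hG hsm hgc) D.hat u K' hcov').EquivariantStructure
    (A.poincarePullback u K hK hcov hG hsm hgc D hfree))

omit [IsReduced S] [IsLocallyNoetherian S] [IsCommMonObj A.X] in
include hfree in
/-- **`|K| · |ker b_s| = |A_s[n]|` for a homomorphism `b : A/K → A` with `ψ ≫ b = [n]_A`** (at every geometric point:
`b_s ∘ ψ_s = (·)^n` on `A_s(Ω)`, `ψ_s` onto with `|ker ψ_s| = |K|` — ★ `natCard_ker_fibreHom_quotientMk` — and
`|ker (b_s ∘ ψ_s)| = |ker ψ_s| · |ker b_s|`, ★ `IsogenyDegree.natCard_ker_comp_of_surjective`, packaged in the abstract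
`finite_ker_and_mul_natCard_eq_of_apply_apply_eq_pow` so that this proof is a single instantiation); used on the DUAL side at
`b := ψ^∨`, `ψ := ψ̂`. [cite: MumfordAV1970, §7 Thm. 4 (p. 72) and §15 Thm. 1 (p. 143)] -/
theorem natCard_mul_natCard_ker_of_quotientMk_comp_eq_mulN
    (b : (A.quotientBy u K hcov hG hsm hgc).X ⟶ A.X) [IsMonHom b]
    (hb : letI : GrpObj (A.quotientOver u K) := (A.quotientBy u K hcov hG hsm hgc).grpObj
      (show A.X ⟶ (A.quotientBy u K hcov hG hsm hgc).X from A.quotientMk u K hcov) ≫ b = A.mulN n)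
    {Ω : Type u} [Field Ω] [IsAlgClosed Ω] (s : Spec (.of Ω) ⟶ S) (hn : (n : Ω) ≠ 0) :
    Finite (IsMonHom.monoidHom (fibreHom b s).hom.hom.hom (specOver Ω Ω)).ker ∧
      Nat.card K * Nat.card (IsMonHom.monoidHom (fibreHom b s).hom.hom.hom (specOver Ω Ω)).ker =
        Nat.card (powMonoidHom n : (A.fibre s).toAbelianVariety.Points Ω →* _).ker := by
  letI : GrpObj (A.quotientOver u K) := (A.quotientBy u K hcov hG hsm hgc).grpObj
  haveI hψ' : @IsMonHom _ _ _ A.X (A.quotientBy u K hcov hG hsm hgc).X _ _ (A.quotientMk u K hcov) :=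
    A.isMonHom_quotientMk u K hcov hG hsm hgc
  have hcomp : ∀ z : (A.fibre s).toAbelianVariety.Points Ω,
      (IsMonHom.monoidHom (fibreHom b s).hom.hom.hom (specOver Ω Ω))
        ((IsMonHom.monoidHom (fibreHom (show A.X ⟶ (A.quotientBy u K hcov hG hsm hgc).X from A.quotientMk u K hcov)
          s).hom.hom.hom (specOver Ω Ω)) z) = z ^ n := by
    intro z
    rw [IsMonHom.monoidHom_apply, IsMonHom.monoidHom_apply, ← AlgPoints.map_apply, ← AlgPoints.map_apply]
    exact algPointsMap_algPointsMap_eq_pow_of_comp_eq_mulN _ _ n hb s z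
  have hsurj : Function.Surjective (IsMonHom.monoidHom (fibreHom (show A.X ⟶ (A.quotientBy u K hcov hG hsm hgc).X
      from A.quotientMk u K hcov) s).hom.hom.hom (specOver Ω Ω)) := by
    intro y
    obtain ⟨x, hx⟩ := surjective_map_fibreHom_of_forall_fibrePoints s _
      (fun y => A.quotientBy_ontoFibres u K hcov hG hsm hgc s y) y
    exact ⟨x, by rw [IsMonHom.monoidHom_apply, ← AlgPoints.map_apply]; exact hx⟩
  have hcardpow : Nat.card (powMonoidHom n : (A.fibre s).toAbelianVariety.Points Ω →* _).ker =
      n ^ (2 * (A.fibre s).toAbelianVariety.dim) :=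
    AbelianVariety.natCard_ker_powMonoidHom_eq (A.fibre s).toAbelianVariety Ω n hn
  have hne : Nat.card (powMonoidHom n : (A.fibre s).toAbelianVariety.Points Ω →* _).ker ≠ 0 := by
    rw [hcardpow]
    exact pow_ne_zero _ (by rintro h; exact hn (by rw [h, Nat.cast_zero]))
  have hcf := A.natCard_ker_fibreHom_quotientMk u K hcov hG hsm hgc hfree s
  exact finite_ker_and_mul_natCard_eq_of_apply_apply_eq_pow _ _ n hcomp hsurj hne hcf

/-- **THE `hasType` FIELD OF THE HECKE QUOTIENT TRIPLE FROM THE CARDINALITIES.**  As ★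
`Polarization.hasType_polarizationDesc_of_count`, with the per-point kernel count replaced by: the dual-side identity
`ψ̂ ≫ ψ^∨ = [n]_Â` (`hψhat`), the integer bookkeeping `|K| = n^g` and `|K|·|K′| = n^{2g}` of the Hecke kernel, the relative
dimension `g` of `A` and the (pointwise) dimension `g` of the fibres of `Â` (`hdim'`; at the Siegel piece ★
`SiegelFineModuliScheme.dim_hat_fibre_eq_of_classify`). [cite: MumfordAV1970, §23 Thm. 2 (p. 231) and §7 Thm. 4 (p. 72)]
[cite: MumfordFogartyKirwan1994, App. 7A (pp. 234–235)] -/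
theorem Polarization.hasType_polarizationDesc_of_cards
    (h4 : ∀ {T : Scheme.{u}} (f : T ⟶ S) (ℒ : (A.quotientBy u K hcov hG hsm hgc).RigidifiedLineBundle f),
      ℒ.FibrewisePicZero →
      ∃! g : {g : T ⟶ (D.hat.quotientBy u K' hcov' hG' hsm' hgc').X.left //
          g ≫ (D.hat.quotientBy u K' hcov' hG' hsm' hgc').X.hom = f},
        Nonempty ((Scheme.Modules.pullback ((A.quotientBy u K hcov hG hsm hgc).baseChangeToProd
          (D.hat.quotientBy u K' hcov' hG' hsm' hgc') f g.1 g.2)).obj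
            (A.poincareQuotRigid u K hK hcov hG hsm hgc D hfree K' hcov' hG' hsm' hgc' Φ) ≅ ℒ.L))
    (pol : A.Polarization D)
    (hlam : ∀ σ : K, A.translation (σ : A.Sections) ≫ pol.lam ≫ D.hat.quotientMk u K' hcov' =
      pol.lam ≫ D.hat.quotientMk u K' hcov')
    (polB : (A.quotientBy u K hcov hG hsm hgc).Polarization
      (A.dualPairOfQuotientRigidified u K hK hcov hG hsm hgc D hfree K' hcov' hG' hsm' hgc' hfree' Φ h4))
    (hpolB : polB.lam = A.polarizationDesc u K hcov D.hat K' hcov' pol.lam hlam)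
    {g : ℕ} {δ : Fin g → ℕ} (hT : pol.HasType δ) (hcop : Nat.Coprime n (∏ i, δ i))
    (hn : ∀ (Ω : Type u) [Field Ω] [IsAlgClosed Ω] (_ : Spec (.of Ω) ⟶ S), (n : Ω) ≠ 0)
    (hlamB : ∀ (Ω : Type u) [Field Ω] [IsAlgClosed Ω] (s : Spec (.of Ω) ⟶ S),
      haveI := polB.isMonHom
      Function.Surjective (AlgPoints.map (L := Ω) (fibreHom polB.lam s).hom.hom.hom))
    (hψhat :
      letI : GrpObj (D.hat.quotientOver u K') := (D.hat.quotientBy u K' hcov' hG' hsm' hgc').grpObj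
      haveI : @IsMonHom _ _ _ A.X (A.quotientBy u K hcov hG hsm hgc).X _ _ (A.quotientMk u K hcov) :=
        A.isMonHom_quotientMk u K hcov hG hsm hgc
      haveI := polB.isMonHom
      haveI := pol.isMonHom
      haveI : IsMonHom (DualPair.dualIsogenyOver
          (show A.X ⟶ (A.quotientBy u K hcov hG hsm hgc).X from A.quotientMk u K hcov) D
          (A.dualPairOfQuotientRigidified u K hK hcov hG hsm hgc D hfree K' hcov' hG' hsm' hgc' hfree' Φ h4)) :=
        DualPair.isMonHom_dualIsogenyOver _ D _ polB.nonempty_unitHatSlice_iso pol.nonempty_unitHatSlice_iso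
      (show D.hat.X ⟶ (D.hat.quotientBy u K' hcov' hG' hsm' hgc').X from D.hat.quotientMk u K' hcov') ≫
        DualPair.dualIsogenyOver (show A.X ⟶ (A.quotientBy u K hcov hG hsm hgc).X from A.quotientMk u K hcov) D
          (A.dualPairOfQuotientRigidified u K hK hcov hG hsm hgc D hfree K' hcov' hG' hsm' hgc' hfree' Φ h4) =
        D.hat.mulN n)
    (hcardK : Nat.card K = n ^ g) (hKK' : Nat.card K * Nat.card K' = n ^ (2 * g)) (hrel : A.IsOfRelDim g)
    (hdim' : ∀ ⦃Ω : Type u⦄ [Field Ω] (s : Spec (.of Ω) ⟶ S), (D.hat.fibre s).toAbelianVariety.dim = g) :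
    polB.HasType δ := by
  letI : GrpObj (A.quotientOver u K) := (A.quotientBy u K hcov hG hsm hgc).grpObj
  letI : GrpObj (D.hat.quotientOver u K') := (D.hat.quotientBy u K' hcov' hG' hsm' hgc').grpObj
  haveI hψ' : @IsMonHom _ _ _ A.X (A.quotientBy u K hcov hG hsm hgc).X _ _ (A.quotientMk u K hcov) :=
    A.isMonHom_quotientMk u K hcov hG hsm hgc
  haveI hψh : @IsMonHom _ _ _ D.hat.X (D.hat.quotientBy u K' hcov' hG' hsm' hgc').X _ _ (D.hat.quotientMk u K' hcov') :=
    D.hat.isMonHom_quotientMk u K' hcov' hG' hsm' hgc'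
  haveI := polB.isMonHom
  haveI := pol.isMonHom
  haveI hmon : IsMonHom (DualPair.dualIsogenyOver
      (show A.X ⟶ (A.quotientBy u K hcov hG hsm hgc).X from A.quotientMk u K hcov) D
      (A.dualPairOfQuotientRigidified u K hK hcov hG hsm hgc D hfree K' hcov' hG' hsm' hgc' hfree' Φ h4)) :=
    DualPair.isMonHom_dualIsogenyOver _ D _ polB.nonempty_unitHatSlice_iso pol.nonempty_unitHatSlice_iso
  -- the same instance keyed on the `(Â/K′).X`-typing of the source of `ψ^∨` (the form the generic count lemma asks for)
  haveI hmon' : @IsMonHom _ _ _ (D.hat.quotientBy u K' hcov' hG' hsm' hgc').X D.hat.X _ _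
      (DualPair.dualIsogenyOver (show A.X ⟶ (A.quotientBy u K hcov hG hsm hgc).X from A.quotientMk u K hcov) D
        (A.dualPairOfQuotientRigidified u K hK hcov hG hsm hgc D hfree K' hcov' hG' hsm' hgc' hfree' Φ h4)) := hmon
  refine Polarization.hasType_polarizationDesc_of_count A u K hK hcov hG hsm hgc D hfree K' hcov' hG' hsm' hgc' hfree' Φ
    h4 pol hlam polB hpolB hT hcop hn hlamB fun Ω _ _ s => ?_
  -- source side: `|ker ψ_s| = |K|`
  have hkerψ := A.natCard_ker_fibreHom_quotientMk u K hcov hG hsm hgc hfree s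
  have hfinψ := A.finite_ker_fibreHom_quotientMk u K hcov hG hsm hgc hfree s
  -- dual side: `|K′| · |ker ψ^∨_s| = |Â_s[n]|` (the generic lemma at `(Â, K′)`, `b := ψ^∨`, `ψ := ψ̂`)
  obtain ⟨hfingd, hprod⟩ := natCard_mul_natCard_ker_of_quotientMk_comp_eq_mulN (A := D.hat) (u := u) (K := K')
    (hcov := hcov') (hG := hG') (hsm := hsm') (hgc := hgc') (hfree := hfree')
    (b := DualPair.dualIsogenyOver (show A.X ⟶ (A.quotientBy u K hcov hG hsm hgc).X from A.quotientMk u K hcov) D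
      (A.dualPairOfQuotientRigidified u K hK hcov hG hsm hgc D hfree K' hcov' hG' hsm' hgc' hfree' Φ h4))
    (hb := hψhat) (s := s) (hn := hn Ω s)
  -- dimensions
  have hdimA : (A.fibre s).toAbelianVariety.dim = g := dim_fibre_of_isOfRelDim hrel s
  have hdimD : (D.hat.fibre s).toAbelianVariety.dim = g := hdim' s
  have hA0 : Nat.card (powMonoidHom n : (A.fibre s).toAbelianVariety.Points Ω →* _).ker =
      n ^ (2 * (A.fibre s).toAbelianVariety.dim) :=
    AbelianVariety.natCard_ker_powMonoidHom_eq (A.fibre s).toAbelianVariety Ω n (hn Ω s)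
  have hA : Nat.card (powMonoidHom n : (A.fibre s).toAbelianVariety.Points Ω →* _).ker = n ^ (2 * g) := by
    rw [hA0, hdimA]
  have hD0 : Nat.card (powMonoidHom n : (D.hat.fibre s).toAbelianVariety.Points Ω →* _).ker =
      n ^ (2 * (D.hat.fibre s).toAbelianVariety.dim) :=
    AbelianVariety.natCard_ker_powMonoidHom_eq (D.hat.fibre s).toAbelianVariety Ω n (hn Ω s)
  have hD : Nat.card (powMonoidHom n : (D.hat.fibre s).toAbelianVariety.Points Ω →* _).ker = n ^ (2 * g) := by
    rw [hD0, hdimD]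
  rw [hD] at hprod
  -- `|ker ψ^∨_s| = |K|`
  have hK'pos : 0 < Nat.card K' := Nat.card_pos
  have hkergd : Nat.card (IsMonHom.monoidHom (fibreHom (DualPair.dualIsogenyOver
      (show A.X ⟶ (A.quotientBy u K hcov hG hsm hgc).X from A.quotientMk u K hcov) D
      (A.dualPairOfQuotientRigidified u K hK hcov hG hsm hgc D hfree K' hcov' hG' hsm' hgc' hfree' Φ h4)) s).hom.hom.hom
      (specOver Ω Ω)).ker = Nat.card K :=
    Nat.eq_of_mul_eq_mul_left hK'pos (hprod.trans (hKK'.symm.trans (Nat.mul_comm _ _)))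
  refine ⟨hfinψ, hfingd, ?_⟩
  rw [hkerψ, hkergd, hA, hcardK, ← pow_add, two_mul]


/-- **THE `hasType` FIELD OF THE HECKE QUOTIENT TRIPLE — (DET)-FREE FORM `|K′| = |K|`.**  As
`Polarization.hasType_polarizationDesc_of_cards`, with the integer bookkeeping replaced by the single equality of cardinalities
`|K′| = |K|` (at the Hecke instance: ★ `natCard_map_lam_eq_of_mem_iff`, `K′ = λ′_* K`), the relative dimension `g'` of `A`
and the pointwise fibre dimension `g'` of `Â` (so `|K|·|ker ψ^∨_s| = |K′|·|ker ψ^∨_s| = |Â_s[n]| = n^{2g'} = |A_s[n]|`, no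
division, no `|K| = n^g`). [cite: MumfordAV1970, §23 Thm. 2 (p. 231) and §7 Thm. 4 (p. 72)]
[cite: MumfordFogartyKirwan1994, App. 7A (pp. 234–235)] -/
theorem Polarization.hasType_polarizationDesc_of_card_eq
    (h4 : ∀ {T : Scheme.{u}} (f : T ⟶ S) (ℒ : (A.quotientBy u K hcov hG hsm hgc).RigidifiedLineBundle f),
      ℒ.FibrewisePicZero →
      ∃! g : {g : T ⟶ (D.hat.quotientBy u K' hcov' hG' hsm' hgc').X.left //
          g ≫ (D.hat.quotientBy u K' hcov' hG' hsm' hgc').X.hom = f},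
        Nonempty ((Scheme.Modules.pullback ((A.quotientBy u K hcov hG hsm hgc).baseChangeToProd
          (D.hat.quotientBy u K' hcov' hG' hsm' hgc') f g.1 g.2)).obj
            (A.poincareQuotRigid u K hK hcov hG hsm hgc D hfree K' hcov' hG' hsm' hgc' Φ) ≅ ℒ.L))
    (pol : A.Polarization D)
    (hlam : ∀ σ : K, A.translation (σ : A.Sections) ≫ pol.lam ≫ D.hat.quotientMk u K' hcov' =
      pol.lam ≫ D.hat.quotientMk u K' hcov')
    (polB : (A.quotientBy u K hcov hG hsm hgc).Polarization
      (A.dualPairOfQuotientRigidified u K hK hcov hG hsm hgc D hfree K' hcov' hG' hsm' hgc' hfree' Φ h4))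
    (hpolB : polB.lam = A.polarizationDesc u K hcov D.hat K' hcov' pol.lam hlam)
    {g : ℕ} {δ : Fin g → ℕ} (hT : pol.HasType δ) (hcop : Nat.Coprime n (∏ i, δ i))
    (hn : ∀ (Ω : Type u) [Field Ω] [IsAlgClosed Ω] (_ : Spec (.of Ω) ⟶ S), (n : Ω) ≠ 0)
    (hlamB : ∀ (Ω : Type u) [Field Ω] [IsAlgClosed Ω] (s : Spec (.of Ω) ⟶ S),
      haveI := polB.isMonHom
      Function.Surjective (AlgPoints.map (L := Ω) (fibreHom polB.lam s).hom.hom.hom))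
    (hψhat :
      letI : GrpObj (D.hat.quotientOver u K') := (D.hat.quotientBy u K' hcov' hG' hsm' hgc').grpObj
      haveI : @IsMonHom _ _ _ A.X (A.quotientBy u K hcov hG hsm hgc).X _ _ (A.quotientMk u K hcov) :=
        A.isMonHom_quotientMk u K hcov hG hsm hgc
      haveI := polB.isMonHom
      haveI := pol.isMonHom
      haveI : IsMonHom (DualPair.dualIsogenyOver
          (show A.X ⟶ (A.quotientBy u K hcov hG hsm hgc).X from A.quotientMk u K hcov) D
          (A.dualPairOfQuotientRigidified u K hK hcov hG hsm hgc D hfree K' hcov' hG' hsm' hgc' hfree' Φ h4)) :=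
        DualPair.isMonHom_dualIsogenyOver _ D _ polB.nonempty_unitHatSlice_iso pol.nonempty_unitHatSlice_iso
      (show D.hat.X ⟶ (D.hat.quotientBy u K' hcov' hG' hsm' hgc').X from D.hat.quotientMk u K' hcov') ≫
        DualPair.dualIsogenyOver (show A.X ⟶ (A.quotientBy u K hcov hG hsm hgc).X from A.quotientMk u K hcov) D
          (A.dualPairOfQuotientRigidified u K hK hcov hG hsm hgc D hfree K' hcov' hG' hsm' hgc' hfree' Φ h4) =
        D.hat.mulN n)
    (hK'K : Nat.card K' = Nat.card K) {g' : ℕ} (hrel : A.IsOfRelDim g')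
    (hdim' : ∀ ⦃Ω : Type u⦄ [Field Ω] (s : Spec (.of Ω) ⟶ S), (D.hat.fibre s).toAbelianVariety.dim = g') :
    polB.HasType δ := by
  letI : GrpObj (A.quotientOver u K) := (A.quotientBy u K hcov hG hsm hgc).grpObj
  letI : GrpObj (D.hat.quotientOver u K') := (D.hat.quotientBy u K' hcov' hG' hsm' hgc').grpObj
  haveI hψ' : @IsMonHom _ _ _ A.X (A.quotientBy u K hcov hG hsm hgc).X _ _ (A.quotientMk u K hcov) :=
    A.isMonHom_quotientMk u K hcov hG hsm hgc
  haveI hψh : @IsMonHom _ _ _ D.hat.X (D.hat.quotientBy u K' hcov' hG' hsm' hgc').X _ _ (D.hat.quotientMk u K' hcov') :=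
    D.hat.isMonHom_quotientMk u K' hcov' hG' hsm' hgc'
  haveI := polB.isMonHom
  haveI := pol.isMonHom
  haveI hmon : IsMonHom (DualPair.dualIsogenyOver
      (show A.X ⟶ (A.quotientBy u K hcov hG hsm hgc).X from A.quotientMk u K hcov) D
      (A.dualPairOfQuotientRigidified u K hK hcov hG hsm hgc D hfree K' hcov' hG' hsm' hgc' hfree' Φ h4)) :=
    DualPair.isMonHom_dualIsogenyOver _ D _ polB.nonempty_unitHatSlice_iso pol.nonempty_unitHatSlice_iso
  -- the same instance keyed on the `(Â/K′).X`-typing of the source of `ψ^∨` (the form the generic count lemma asks for)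
  haveI hmon' : @IsMonHom _ _ _ (D.hat.quotientBy u K' hcov' hG' hsm' hgc').X D.hat.X _ _
      (DualPair.dualIsogenyOver (show A.X ⟶ (A.quotientBy u K hcov hG hsm hgc).X from A.quotientMk u K hcov) D
        (A.dualPairOfQuotientRigidified u K hK hcov hG hsm hgc D hfree K' hcov' hG' hsm' hgc' hfree' Φ h4)) := hmon
  refine Polarization.hasType_polarizationDesc_of_count A u K hK hcov hG hsm hgc D hfree K' hcov' hG' hsm' hgc' hfree' Φ
    h4 pol hlam polB hpolB hT hcop hn hlamB fun Ω _ _ s => ?_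
  -- source side: `|ker ψ_s| = |K|`
  have hkerψ := A.natCard_ker_fibreHom_quotientMk u K hcov hG hsm hgc hfree s
  have hfinψ := A.finite_ker_fibreHom_quotientMk u K hcov hG hsm hgc hfree s
  -- dual side: `|K′| · |ker ψ^∨_s| = |Â_s[n]|` (the generic lemma at `(Â, K′)`, `b := ψ^∨`, `ψ := ψ̂`)
  obtain ⟨hfingd, hprod⟩ := natCard_mul_natCard_ker_of_quotientMk_comp_eq_mulN (A := D.hat) (u := u) (K := K')
    (hcov := hcov') (hG := hG') (hsm := hsm') (hgc := hgc') (hfree := hfree')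
    (b := DualPair.dualIsogenyOver (show A.X ⟶ (A.quotientBy u K hcov hG hsm hgc).X from A.quotientMk u K hcov) D
      (A.dualPairOfQuotientRigidified u K hK hcov hG hsm hgc D hfree K' hcov' hG' hsm' hgc' hfree' Φ h4))
    (hb := hψhat) (s := s) (hn := hn Ω s)
  -- dimensions
  have hdimA : (A.fibre s).toAbelianVariety.dim = g' := dim_fibre_of_isOfRelDim hrel s
  have hdimD : (D.hat.fibre s).toAbelianVariety.dim = g' := hdim' s
  have hA0 : Nat.card (powMonoidHom n : (A.fibre s).toAbelianVariety.Points Ω →* _).ker =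
      n ^ (2 * (A.fibre s).toAbelianVariety.dim) :=
    AbelianVariety.natCard_ker_powMonoidHom_eq (A.fibre s).toAbelianVariety Ω n (hn Ω s)
  have hA : Nat.card (powMonoidHom n : (A.fibre s).toAbelianVariety.Points Ω →* _).ker = n ^ (2 * g') := by
    rw [hA0, hdimA]
  have hD0 : Nat.card (powMonoidHom n : (D.hat.fibre s).toAbelianVariety.Points Ω →* _).ker =
      n ^ (2 * (D.hat.fibre s).toAbelianVariety.dim) :=
    AbelianVariety.natCard_ker_powMonoidHom_eq (D.hat.fibre s).toAbelianVariety Ω n (hn Ω s)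
  have hD : Nat.card (powMonoidHom n : (D.hat.fibre s).toAbelianVariety.Points Ω →* _).ker = n ^ (2 * g') := by
    rw [hD0, hdimD]
  rw [hD, hK'K] at hprod
  refine ⟨hfinψ, hfingd, ?_⟩
  rw [hkerψ, hA]
  exact hprod

end AbelianSchemeOver

end Literature.AlgebraicGeometry.AbelianSchemes

end
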